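import Summits.QuantumFields.YangMills.Theorems.BalabanUVNodesN18AtWalkRecords
import Summits.QuantumFields.BalabanUV.T4Continuum.Spine.NE5.TwoRunTorusNE5All8
import Summits.QuantumFields.BalabanUV.T4Continuum.Spine.NE5.TwoRunTorusNE5Sizes

/-!
# BalabanUVNodes ∕ N18 — route P1's W2 DATUM `hH` ON THE RECORD's TORUS CATALOGUE FROM WALK RECORDS OVER THE DATA SPACE WITH THE
# CONSTANTS EXHIBITED: the H-layer activity datum of `EnvelopeOnRecord.outputEnvelope_of_activities_record` (what
# `ne5_of_leaves_activities` consumes) — Bałaban's constants record `c` (any `L ≥ 8`), the (2.20)∕(2.22) size constants and ONE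
# walk package for all scales exported BEFORE the data; Lemma 3's printed restrictions and the p. 17 numerics DISCHARGED
# (Track A, DAG node N18 = NE5 `T4OutputRate.NE5 EA EB W κ θ C₅` :211; cluster K4 «SpineRates»; file 8 of seat pub-ymgap-dag-n18-c;
# companion of file 7 `BalabanUVNodesN18AtWalkRecordsSized` at the `hH` level)

HONEST FRAMING.  Count-neutral kernel bookkeeping (seat pub-ymgap-dag-n18-c g2; `--supports stmt-QuantumFields-19676`): pure
composition BY NAME of T52 `TwoRunTorusNE5All8.lemma3_witness_all8`, T46 `TwoRunTorusNE5Sizes.scalars_sized` (read at the trivial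
window `θ := 1`: ONE package for all scales, configuration size `α = max 2 s` for a margin bound `s`) and file 6
`N18AtWalkRecords.hH_of_termWalkData_record` (file 4 ∘ file 5: T25 + T28 per term in the data direction ∘ file 1
`N18HLayerDatum.hH_of_terms226_record`).  THE ROW's OBJECT («the H-layer ACTIVITY DATUM on the record's torus catalogue: instance +
estimate»): INSTANCE `act j z Z := Σ_{t ∈ terms L M Z} T j Z t z` (file 1); ESTIMATE = holomorphy in the data on an open
`V ⊇ M.box j p` and the majorant `C₃ε₁·e^{−(1−8δ)½Lκ·d(Z)}` there, now with EVERY numerics binder discharged and the walk package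
EXHIBITED; what REMAINS a hypothesis: per (scale, admissible base point, term) ONE record `𝒦 : TermKernels c⁺ 4 (R.cubesPerDir j) ν
(Nf j) (Op × Hist)` with `TermWalkData 𝒦 (w j)` for the exported package — NODE O's statement (v) in the data direction, instance
0∕1, NOT claimed; σ-holomorphy (NODE O); SYMMETRY (NODE A); potentials with (2.20), `χ` with (2.22) at the exported `γ₂, r_P`;
fibre ∕ size bounds; the identification `hT`; margins `< s`.  NE5 NOT IN PRINT ([Balaban1987RG1] Thm 1 p. 259) and NOT PROVED;
NOT a node discharge; one finite four-torus programme at fixed ε; nothing continuum ∕ ℝ⁴ ∕ OS ∕ mass-gap ∕ Clay.  0 `def`,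
0 `sorry`.

Sources: T. Bałaban, CMP **109** (1987) [Balaban1987RG1] p. 251 (`L`), Thm 1 p. 259; CMP **116** (1988) [Balaban1988RG2Cluster]
(1.5) p. 3, p. 5, p. 13, p. 15, (2.14)–(2.18) pp. 15–16, (2.20)–(2.26) pp. 16–17, Lemma 3 (2.38) p. 20; CMP **99** (1985)
[Balaban1985BackgroundPropagators] Thm 3.10 p. 416; C. King, CMP **102** (1986) [King1986] p. 665.  Nothing here is a claim
about the Yang–Mills mass gap.
-/

noncomputable section

namespace Summit.QuantumFields.YangMills.BalabanUVNodes.N18HLayerWalkRecordsSized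

open Matrix Set Metric Finset
open Literature.MathematicalPhysics.QuantumFieldTheory.Balaban1983to89
open Literature.MathematicalPhysics.QuantumFieldTheory.Balaban1983to89.T4OutputRate
open Literature.MathematicalPhysics.QuantumFieldTheory.Balaban1983to89.T4InputCauchyRateData
open Literature.MathematicalPhysics.QuantumFieldTheory.Balaban1983to89.TreeLengthTorus (TPt TDom tsys torusTreeLen)
open Literature.MathematicalPhysics.QuantumFieldTheory.Balaban1983to89.TreeLengthTorusTransfer (tclosure)
open Literature.MathematicalPhysics.QuantumFieldTheory.Balaban1983to89.B13Lemma3TorusData (TBond)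
open Literature.MathematicalPhysics.QuantumFieldTheory.Balaban1983to89.B13Lemma3TorusTerms (terms weight Z0)
open Literature.MathematicalPhysics.QuantumFieldTheory.Balaban1983to89.B13Term214 (core214 F214 term214)
open Literature.MathematicalPhysics.QuantumFieldTheory.Balaban1983to89.B13Bound143 (invTau)
open Literature.MathematicalPhysics.QuantumFieldTheory.Balaban1983to89.B5TorusCover (UT)
open Literature.MathematicalPhysics.QuantumFieldTheory.Balaban1983to89.B13TermWalkData
  (WalkConsts TermKernels TermWalkData)
open Summit.QuantumFields.BalabanUV.T4Continuum.B13Carriers (TwoRuns)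
open Summit.QuantumFields.BalabanUV.T4Continuum.Spine.NE5
open Summit.QuantumFields.BalabanUV.T4Continuum.Spine.NE5.TwoRunTorusNE5All8 (lemma3_witness_all8)
open Summit.QuantumFields.BalabanUV.T4Continuum.Spine.NE5.TwoRunTorusNE5Sizes (scalars_sized)
open Summit.QuantumFields.YangMills.BalabanUVNodes.N18AtWalkRecords (hH_of_termWalkData_record)

/-- **ROUTE P1's W2 DATUM `hH` FROM PER-BASE-POINT WALK RECORDS OVER THE DATA SPACE — THE PRODUCER's ORDER, THE CONSTANTS
EXHIBITED.**  For EVERY block size `L ≥ 8` there is ONE constants record `c` with `c.L = L` (`1 ≤ c.κ₁`, `0 < c.ε₁`, (2.18)) such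
that for all fine-cover data, walk letters `K̄_Γ, K̄_E, K̄_C ≥ 0`, `ε, κ > 0`, fibre number `m` and sizes `n_Λ, n_N ≥ 0` there are
constants `C_R > 2`, `C_σ`, `γ₂ > 0, a₂₀ ≥ 0, w₀ > 0` such that for every margin bound `s > 0`, floor `R_σ0` and bond-cube side
`M ≥ 1` there are packages `w j` (letters the given ones, `R = max 2 s · C_R`, `R_σ = max R_σ0 C_σ`), sizes `α j = max 2 s` and `r_P`
such that: for every two-run datum `R`, data spaces, ONE step model `M` with margins `< s`, τ-regions, contour radius, enumerations,
per scale ∕ admissible base point ∕ term walk records `𝒦 j p Z t` over `Op × Hist` with `TermWalkData (𝒦 j p Z t) (w j)`,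
σ-holomorphy, SYMMETRY, potentials with (2.20) (`w₂₀ ≤ w₀|Z|`), `χ` with (2.22) at `γ₂, r_P`, fibre ∕ size bounds and the
identification `hT` — the H-layer datum `hH` of `EnvelopeOnRecord.outputEnvelope_of_activities_record` VERBATIM for the term-sum
activities, with `A = C₃ε₁` and `R_d = (1−8δ)½L·c.κ` (file 6 `hH_of_termWalkData_record`, every numerics binder of it discharged by
T52 + T46 at `θ := 1`).
[cite: Balaban1987RG1, p.251, Thm 1 p.259; Balaban1988RG2Cluster, (1.5) p.3, p.5, p.13, p.15, (2.14)–(2.18) pp.15–16, (2.20)–(2.26) pp.16–17, (2.38) p.20; Balaban1985BackgroundPropagators, Thm 3.10 p.416; King1986, p.665] -/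
theorem hH_of_termWalkData_sized :
    ∀ (L : ℕ) [NeZero L], 8 ≤ L →
      ∃ c : B13.Consts, c.L = L ∧ 1 ≤ c.κ₁ ∧ 0 < c.ε₁ ∧ (∀ d : ℝ, 0 ≤ d → 0 < invTau c d ∧ invTau c d ≤ 1 / 2) ∧
      ∀ {ν : ℕ} {Nf : ℕ → Fin ν → ℕ} [∀ j i, NeZero (Nf j i)],
      ∀ {KΓ KE KC ε kap : ℝ}, 0 ≤ KΓ → 0 ≤ KE → 0 ≤ KC → 0 < ε → 0 < kap → ∀ (m : ℕ) {nΛ nN : ℝ}, 0 ≤ nΛ → 0 ≤ nN →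
      ∃ (CR Cσ γ₂ a₂₀ w₀ : ℝ), 2 < CR ∧ 0 < γ₂ ∧ 0 ≤ a₂₀ ∧ 0 < w₀ ∧
      ∀ {s : ℝ}, 0 < s → ∀ (Rσ₀ : ℝ) (Mb : ℕ) [NeZero Mb],
      ∃ (w : ℕ → WalkConsts) (α : ℕ → ℝ) (rP : ℝ),
      (∀ j, (w j).Admissible (α j) Rσ₀) ∧ (∀ j, α j = max 2 s) ∧
      (∀ j, (w j).KbarΓ = KΓ ∧ (w j).KbarE = KE ∧ (w j).KbarC = KC ∧ (w j).kap = kap ∧ (w j).ε = ε) ∧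
      (∀ j, (w j).R = max 2 s * CR) ∧ (∀ j, (w j).Rσ = max Rσ₀ Cσ) ∧
      ∀ (G : Type) [GaugeGroup G] (R : TwoRuns G)
        (Op Hist : Type) [NormedAddCommGroup Op] [NormedSpace ℂ Op] [NormedAddCommGroup Hist] [NormedSpace ℂ Hist]
        (M : StepModel R.carriers Op Hist) {W : Set (ℕ → ℝ)}
        -- the (2.18) τ-regions, the contour radius, the enumerations, per scale
        {Uτ : (j : ℕ) → TDom 4 (L * R.cubesPerDir j) → Set ℂ}, (∀ j Y, IsOpen (Uτ j Y)) →
        (∀ j, ∀ Y : TDom 4 (L * R.cubesPerDir j),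
          closedBall (0 : ℂ) ((invTau c ((tsys 4 (L * R.cubesPerDir j)).dj Y))⁻¹) ⊆ Uτ j Y) →
        ∀ {r : ℝ}, 0 < r → r ≤ Real.exp c.κ₁ - 1 → (∀ j Y, ∀ ζ ∈ Set.uIcc (0 : ℝ) 1, closedBall (ζ : ℂ) r ⊆ Uτ j Y) →
        ∀ (lZ : (j : ℕ) → TDom 4 (R.cubesPerDir j) →
            Finset (TDom 4 (L * R.cubesPerDir j)) × Finset (TBond 4 Mb (L * R.cubesPerDir j)) → List (TPt 4 (R.cubesPerDir j))),
        (∀ j Z t, (lZ j Z t).Nodup ∧ (lZ j Z t).toFinset = Z.1 \ tclosure L (R.cubesPerDir j) (Z0 Mb t)) →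
        ∀ (lD : (j : ℕ) → Finset (TDom 4 (L * R.cubesPerDir j)) × Finset (TBond 4 Mb (L * R.cubesPerDir j)) →
            List (TDom 4 (L * R.cubesPerDir j))),
        (∀ j t, (lD j t).Nodup ∧ (lD j t).toFinset = t.1) →
        -- PER SCALE, PER BASE POINT, PER TERM: THE WALK RECORDS AT `c⁺` OVER THE DATA SPACE, FOR THE EXPORTED PACKAGE
        ∀ (𝒦 : (j : ℕ) → Op × Hist → (Z : TDom 4 (R.cubesPerDir j)) →
            Finset (TDom 4 (L * R.cubesPerDir j)) × Finset (TBond 4 Mb (L * R.cubesPerDir j)) →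
            TermKernels ({ c with κ₁ := c.κ₁ + 1 } : B13.Consts) 4 (R.cubesPerDir j) ν (Nf j) (Op × Hist))
          [∀ j p Z t, Fintype (𝒦 j p Z t).C₀] [∀ j p Z t, DecidableEq (𝒦 j p Z t).C₀],
        (∀ j, ∀ g ∈ W, ∀ (U : R.carriers.BgB) (p : Op × Hist), p ∈ M.Base j g U →
          ∀ Z, ∀ t ∈ terms L Mb Z, TermWalkData (𝒦 j p Z t) (w j)) →
        ∀ (Γ : (j : ℕ) → (p : Op × Hist) → (Z : TDom 4 (R.cubesPerDir j)) →
            (t : Finset (TDom 4 (L * R.cubesPerDir j)) × Finset (TBond 4 Mb (L * R.cubesPerDir j))) → Op × Hist →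
            (TPt 4 (R.cubesPerDir j) → ℂ) → ((𝒦 j p Z t).Λ ⊕ (𝒦 j p Z t).C₀ → ℝ) → ((𝒦 j p Z t).Λ → ℂ)),
        (∀ j, ∀ g ∈ W, ∀ (U : R.carriers.BgB) (p : Op × Hist), p ∈ M.Base j g U →
          ∀ Z, ∀ t ∈ terms L Mb Z, ∀ u ∈ ball (0 : Op × Hist) (α j), ∀ σ : TPt 4 (R.cubesPerDir j) → ℂ,
          (∀ i, σ i ∈ ball (0 : ℂ) (Real.exp (c.κ₁ + 1))) →
            ∀ X : (𝒦 j p Z t).Λ ⊕ (𝒦 j p Z t).C₀ → ℝ,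
              Γ j p Z t u σ X = (𝒦 j p Z t).G2 σ u *ᵥ fun i => (X i : ℂ)) →
        ∀ (χY₀ χcP : (j : ℕ) → (p : Op × Hist) → (Z : TDom 4 (R.cubesPerDir j)) →
            (t : Finset (TDom 4 (L * R.cubesPerDir j)) × Finset (TBond 4 Mb (L * R.cubesPerDir j))) →
            ((𝒦 j p Z t).Λ → ℝ) → ℝ),
        (∀ j, ∀ g ∈ W, ∀ (U : R.carriers.BgB) (p : Op × Hist), p ∈ M.Base j g U →
          ∀ Z, ∀ t ∈ terms L Mb Z, ∀ Bf, 0 ≤ χY₀ j p Z t Bf) →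
        (∀ j, ∀ g ∈ W, ∀ (U : R.carriers.BgB) (p : Op × Hist), p ∈ M.Base j g U →
          ∀ Z, ∀ t ∈ terms L Mb Z, ∀ Bf, 0 ≤ χcP j p Z t Bf) →
        ∀ (Dfam : (j : ℕ) → Op × Hist → TDom 4 (R.cubesPerDir j) →
            Finset (TDom 4 (L * R.cubesPerDir j)) × Finset (TBond 4 Mb (L * R.cubesPerDir j)) →
            Finset (TDom 4 (L * R.cubesPerDir j)))
          (Vk : (j : ℕ) → (p : Op × Hist) → (Z : TDom 4 (R.cubesPerDir j)) →
            (t : Finset (TDom 4 (L * R.cubesPerDir j)) × Finset (TBond 4 Mb (L * R.cubesPerDir j))) → Op × Hist →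
            TDom 4 (L * R.cubesPerDir j) → ((𝒦 j p Z t).Λ → ℝ) → ℂ),
        -- non-walk data at admissible base points: σ-holomorphy (NODE O), symmetry (NODE A), potentials, measurability
        (∀ j, ∀ g ∈ W, ∀ (U : R.carriers.BgB) (p : Op × Hist), p ∈ M.Base j g U →
          ∀ Z, ∀ t ∈ terms L Mb Z, ∀ u ∈ ball (0 : Op × Hist) (α j), ∀ i i',
          DifferentiableOn ℂ (fun σ => (𝒦 j p Z t).A2 σ u i i') {σ | ∀ i, σ i ∈ ball (0 : ℂ) (Real.exp (c.κ₁ + 1))}) →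
        (∀ j, ∀ g ∈ W, ∀ (U : R.carriers.BgB) (p : Op × Hist), p ∈ M.Base j g U →
          ∀ Z, ∀ t ∈ terms L Mb Z, ∀ u ∈ ball (0 : Op × Hist) (α j), ∀ i i',
          DifferentiableOn ℂ (fun σ => (𝒦 j p Z t).G2 σ u i i') {σ | ∀ i, σ i ∈ ball (0 : ℂ) (Real.exp (c.κ₁ + 1))}) →
        (∀ j, ∀ g ∈ W, ∀ (U : R.carriers.BgB) (p : Op × Hist), p ∈ M.Base j g U →
          ∀ Z, ∀ t ∈ terms L Mb Z, ∀ Y Bf, DifferentiableOn ℂ (fun u => Vk j p Z t u Y Bf) (ball (0 : Op × Hist) (α j))) →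
        (∀ j, ∀ g ∈ W, ∀ (U : R.carriers.BgB) (p : Op × Hist), p ∈ M.Base j g U →
          ∀ Z, ∀ t ∈ terms L Mb Z, Measurable (χY₀ j p Z t)) →
        (∀ j, ∀ g ∈ W, ∀ (U : R.carriers.BgB) (p : Op × Hist), p ∈ M.Base j g U →
          ∀ Z, ∀ t ∈ terms L Mb Z, Measurable (χcP j p Z t)) →
        (∀ j, ∀ g ∈ W, ∀ (U : R.carriers.BgB) (p : Op × Hist), p ∈ M.Base j g U →
          ∀ Z, ∀ t ∈ terms L Mb Z, ∀ u ∈ ball (0 : Op × Hist) (α j), ∀ Y, Measurable (Vk j p Z t u Y)) →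
        (∀ j, ∀ g ∈ W, ∀ (U : R.carriers.BgB) (p : Op × Hist), p ∈ M.Base j g U →
          ∀ Z, ∀ t ∈ terms L Mb Z, ∀ u : Op × Hist, ‖u‖ ≤ α j → ∀ σ : TPt 4 (R.cubesPerDir j) → ℂ,
          (∀ i, ‖σ i‖ ≤ Real.exp (c.κ₁ + 1)) → ((𝒦 j p Z t).A2 σ u).IsSymm) →
        -- (2.22) at the exported `γ₂, r_P` and (2.20) with `w₂₀ ≤ w₀|Z|`, uniform along the data space
        ∀ {w₂₀ : ℝ} (qP : (j : ℕ) → (p : Op × Hist) → (Z : TDom 4 (R.cubesPerDir j)) →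
            (t : Finset (TDom 4 (L * R.cubesPerDir j)) × Finset (TBond 4 Mb (L * R.cubesPerDir j))) →
            ((𝒦 j p Z t).Λ → ℝ) → ℝ),
        (∀ j, ∀ g ∈ W, ∀ (U : R.carriers.BgB) (p : Op × Hist), p ∈ M.Base j g U →
          ∀ Z, ∀ t ∈ terms L Mb Z, ∀ Bf, χY₀ j p Z t Bf * χcP j p Z t Bf ≤
            Real.exp (-(γ₂ / 2 * rP ^ 2 * (t.2.card : ℕ)) + γ₂ / 2 * qP j p Z t Bf)) →
        (∀ j, ∀ g ∈ W, ∀ (U : R.carriers.BgB) (p : Op × Hist), p ∈ M.Base j g U →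
          ∀ Z, ∀ t ∈ terms L Mb Z, ∀ Bf, qP j p Z t Bf ≤ Bf ⬝ᵥ Bf) →
        (∀ j, ∀ g ∈ W, ∀ (U : R.carriers.BgB) (p : Op × Hist), p ∈ M.Base j g U →
          ∀ Z, ∀ t ∈ terms L Mb Z, ∀ u ∈ ball (0 : Op × Hist) (α j), ∀ τ : TDom 4 (L * R.cubesPerDir j) → ℂ,
          (∀ Y, τ Y ∈ Uτ j Y) →
            ∀ Bf, ∑ Y ∈ Dfam j p Z t, ‖τ Y‖ * ‖Vk j p Z t u Y Bf‖ ≤ a₂₀ / 2 * (Bf ⬝ᵥ Bf) + w₂₀) →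
        (∀ j, ∀ Z : TDom 4 (R.cubesPerDir j), w₂₀ ≤ w₀ * ((Z.1).card : ℝ)) →
        -- fibre and size bounds
        (∀ j, ∀ g ∈ W, ∀ (U : R.carriers.BgB) (p : Op × Hist), p ∈ M.Base j g U →
          ∀ Z, ∀ t ∈ terms L Mb Z, (𝒦 j p Z t).m ≤ m) →
        (∀ j, ∀ g ∈ W, ∀ (U : R.carriers.BgB) (p : Op × Hist), p ∈ M.Base j g U →
          ∀ Z, ∀ t ∈ terms L Mb Z, ∀ x : UT (Nf j), (Finset.univ.filter fun i => (𝒦 j p Z t).locN i = x).card ≤ m) →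
        (∀ j, ∀ g ∈ W, ∀ (U : R.carriers.BgB) (p : Op × Hist), p ∈ M.Base j g U →
          ∀ Z, ∀ t ∈ terms L Mb Z, (Fintype.card (𝒦 j p Z t).Λ : ℝ) ≤ nΛ * ((Z.1).card : ℝ)) →
        (∀ j, ∀ g ∈ W, ∀ (U : R.carriers.BgB) (p : Op × Hist), p ∈ M.Base j g U →
          ∀ Z, ∀ t ∈ terms L Mb Z, (Fintype.card ((𝒦 j p Z t).Λ ⊕ (𝒦 j p Z t).C₀) : ℝ) ≤ nN * ((Z.1).card : ℝ)) →
        -- the step's term functions ARE the records' (2.14)-display in the displacement from the base point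
        ∀ (T : (j : ℕ) → (Z : TDom 4 (R.cubesPerDir j)) →
            Finset (TDom 4 (L * R.cubesPerDir j)) × Finset (TBond 4 Mb (L * R.cubesPerDir j)) → Op × Hist → ℂ),
        (∀ j, ∀ g ∈ W, ∀ (U : R.carriers.BgB) (p : Op × Hist), p ∈ M.Base j g U →
          ∀ Z, ∀ t ∈ terms L Mb Z, ∀ u ∈ ball (0 : Op × Hist) (α j), T j Z t (p + u) =
            term214 r (lZ j Z t) (lD j t) (core214 (fun σ => (𝒦 j p Z t).A2 σ u) (Γ j p Z t u)
              (F214 t.2.card (χY₀ j p Z t) (χcP j p Z t) (Dfam j p Z t) (Vk j p Z t u))) 0 0) →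
        -- the margins are below the exported configuration size
        (∀ j, M.rOp j < s ∧ M.rHist j < s) →
        ∀ j, ∀ g ∈ W, ∀ (U : R.carriers.BgB) (p : Op × Hist), p ∈ M.Base j g U →
          ∃ V : Set (Op × Hist), IsOpen V ∧ M.box j p ⊆ V ∧
            (∀ Z : TDom 4 (R.cubesPerDir j),
              DifferentiableOn ℂ (fun z : Op × Hist => ∑ t ∈ terms L Mb Z, T j Z t z) V) ∧
            (∀ z ∈ V, ∀ Z : TDom 4 (R.cubesPerDir j), ‖∑ t ∈ terms L Mb Z, T j Z t z‖ ≤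
              c.C3act * c.ε₁ * Real.exp (-((1 - 8 * c.δ) * ((c.L : ℝ) / 2) * c.κ * torusTreeLen Z.1))) := by
  obtain ⟨a₂, a₂', a₅, Aabs, Bc, hcL⟩ := lemma3_witness_all8
  intro L _ hLL
  obtain ⟨c, hLc, hc⟩ := hcL L hLL
  -- the clauses on `c` alone and `0 < a₅`, read at `M = 1`
  obtain ⟨-, hL, -, hε₁, -, -, -, -, -, -, -, -, -, -, -, -, -, -, -, -, -, -, -, -, -, -, -, -, -,
    -, -, -, -, -, -, -, -, -, -, ha₅, hκ₁, hτ⟩ := hc 1 Nat.one_pos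
  refine ⟨c, hLc, hκ₁, hε₁, hτ, ?_⟩
  intro ν Nf _ KΓ KE KC ε kap hKΓ hKE hKC hε hkap m nΛ nN hnΛ hnN
  -- T46 §2: the scale-free letters and the two size constants, from the O(1) letters and `a₅` alone
  have hκa : 4 * kap / 5 < kap := by linarith
  have hκb : 3 * kap / 5 < 4 * kap / 5 := by linarith
  have h2 : 2 * kap / 5 < 3 * kap / 5 := by linarith
  have h1 : kap / 5 < 2 * kap / 5 := by linarith
  have h0 : 0 < kap / 5 := by linarith
  obtain ⟨ϑ, cE, g, γ₂, a₂₀, w₀, CR, Cσ, -, -, -, hγ₂, ha₂₀, hw₀, hCR, hαc, hsmallG, hsz⟩ :=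
    scalars_sized hKΓ hKE hKC hε hkap (Nat.cast_nonneg m) ν hκa hκb h2 h1 h0 hnΛ hnN ha₅
  refine ⟨CR, Cσ, γ₂, a₂₀, w₀, hCR, hγ₂, ha₂₀, hw₀, ?_⟩
  intro s hs Rσ₀ Mb _
  obtain ⟨a, -, -, -, hα₆, hε₀, hδ, hδ7, hκc, ha, hR15, hR16, hR16', hR17, h231,
    ha₂, hκ229, hsm229, habsk, h18half, h18, ha₂', hκ229', hsm229', hR20, ha₅0, habs, hAc, hC3, -, -,
    -, -, -, -, -, -, -, -, -, -, -⟩ := hc Mb (Nat.pos_of_ne_zero (NeZero.ne Mb))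
  -- the trivial window `θ := 1`: ONE package for all scales, configuration size `max 2 s`
  obtain ⟨w, α, rP, hw, hα1, -, hsm, hκaw, hlett, hαeq, hReq, hRσeq, hR1, hKθ, hcEj, hgEj, hRe, hPa, hvol⟩ :=
    hsz 1 s Rσ₀ a ha
  have hαeq' : ∀ j, α j = max 2 s := fun j => by rw [hαeq j, one_pow, div_one]
  have hReq' : ∀ j, (w j).R = max 2 s * CR := fun j => by rw [hReq j, one_pow, div_one]
  have hsα : ∀ j, s ≤ α j := fun j => (hαeq' j).symm ▸ le_max_right 2 s
  refine ⟨w, α, rP, hw, hαeq', hlett, hReq', hRσeq, ?_⟩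
  intro G _ R Op Hist _ _ _ _ M W Uτ hUτ hUtau r hr hr' hsubτ lZ hlZ lD hlD 𝒦 _ _ h𝒦 Γ hlin χY₀ χcP hχ0 hχc0 Dfam Vk
    hAhol hGhol hVholb hχm hχcm hVm hAs w₂₀ qP h222 hqP h220U hw₂₀ hm hfibN hΛ hN T hT hμ
  exact hH_of_termWalkData_record R c hL hLc hα₆ hε₀ hδ hδ7 hκc ha hR15 hR16 hR16' hR17 h231 ha₂ hκ229 hsm229 habsk
    h18half h18 ha₂' hκ229' hsm229' hR20 ha₅0 habs hAc hC3 M hκ₁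
    (fun j Y => (hτ _ ((tsys 4 (L * R.cubesPerDir j)).dj_nonneg Y)).1)
    (fun j Y => (hτ _ ((tsys 4 (L * R.cubesPerDir j)).dj_nonneg Y)).2) hUτ hUtau hr hr' hsubτ lZ hlZ lD hlD 𝒦
    (Rσ₀ := fun _ => Rσ₀) hw (fun j => one_pos.trans (hα1 j)) h𝒦 Γ hlin χY₀ χcP hχ0 hχc0 Dfam Vk hAhol hGhol hVholb hχm
    hχcm hVm hAs qP h222 hγ₂.le hqP ha₂₀ h220U hm hfibN hκaw hκb h2 h1 h0 hsm
    (fun j g' hg U p hp Z t ht => hR1 j _ (Nat.cast_nonneg _) (Nat.cast_le.2 (hm j g' hg U p hp Z t ht))) hKθ hcEj hgEj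
    hRe hαc hsmallG hPa
    (fun j g' hg U p hp Z t ht => hvol j _ _ _ _ (Nat.cast_nonneg _) (Nat.cast_nonneg _) (Nat.cast_nonneg _)
      (hΛ j g' hg U p hp Z t ht) (hN j g' hg U p hp Z t ht) (hw₂₀ j Z))
    T hT (fun j => (hμ j).1.trans_le (hsα j)) (fun j => (hμ j).2.trans_le (hsα j))

end Summit.QuantumFields.YangMills.BalabanUVNodes.N18HLayerWalkRecordsSized

end
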